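import Literature.MathematicalPhysics.QuantumFieldTheory.AbelianFreeBoundaryWilsonLoopLimit
import Literature.MathematicalPhysics.QuantumFieldTheory.LatticeGaugePlaquetteLowerBound
import HarnessLib

/-!
# The quark potential of Ising lattice gauge theory exists at every coupling
# (Forsström–Viklund 2025, Corollary 6.4), with the infinite-volume `ℤ_n` Wilson loops

M. P. Forsström, F. Viklund, *Current expansion and couplings for Ising lattice gauge theory*,
arXiv:2502.19942 [ForsstromViklund2025currents]. §1.1 (p. 3): «For `β ≥ 0`, let `⟨W_γ⟩_β` denote
the infinite volume limit of its expected value: `⟨W_γ⟩_β := lim_{N → ∞} E_{β,N}[W_γ]`. See, e.g.,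
[FLV2020] for a proof of the existence of this limit» — typed for all `ℤ_n`, all `d`, as
`znWilsonLoopLimit` on top of `hasBoxLimit_zdExpect_zn_wilsonLoop` (FLV Thm 4.1,
`AbelianFreeBoundaryWilsonLoopLimit.lean`). §6, **Corollary 6.4** (p. 10):

«Let `γ` be an axis-parallel rectangle with side-lengths `R, T`. Then for any `β`, the quark
potential `V_β(R) = -lim_{T → ∞} (1/T) log ⟨W_{γ_{R,T}}⟩_β` exists.
*Proof.* By part (i) of Proposition 6.3, `T ↦ -log⟨W_{γ_{R,T}}⟩_β` is subadditive. Applying Fekete's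
lemma, we obtain the desired conclusion.»

Everything below is PROVED (no named fact), following the printed proof: Prop. 6.3 (i)
(Griffiths' second inequality `E[W_{γ₁}]E[W_{γ₂}] ≤ E[W_{γ₁+γ₂}]`) is the tree's
`zdExpect_zn_wilsonLoop_mul_ge` (two-loop Ginibre inequality in the free-boundary region) combined
with the pointwise gluing identity `W_{R×(T₁+T₂)} = W_{R×T₁}(x) · W_{R×T₂}(x + T₁eⱼ)` of `ℤ₂` Wilson
loops (`zdWilsonLoop_z2_add_right`; the `ℤ₂`-sum of the two adjacent loops is the big loop, the
common edge cancelling); translation invariance of the limit (FLV Thm 4.1 (ii)) identifies the two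
factors' limits; Fekete's lemma is Mathlib's `Subadditive.tendsto_lim`. The positivity
`⟨W_{γ_{R,T}}⟩_β > 0` needed to take logarithms (implicit in print; FV Prop. 6.2 `E_{N,β}[W_γ] > 0`)
is obtained from the same supermultiplicativity in BOTH directions and the single plaquette:
`⟨W_{R×T}⟩_β ≥ (tanh β)^{RT}` (`tanh_pow_le_znWilsonLoopLimit_two`), where the plaquette bound
`⟨W_p⟩_{Λ,β} ≥ tanh β` (`tanh_le_zdExpect_z2_plaquette`) is Ginibre monotonicity down to the
one-plaquette system, whose mean is `tanh β` (`singlePlaquetteMean_z2`; the «`β_p = 0`»-type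
evaluation of Marra–Miracle-Solé 1979 p. 235 for one plaquette).

## Main statements

* `znWilsonLoopLimit n β x i j R T` — `⟨W_{γ_{R,T}}(x)⟩_β` for the `ℤ_n` theory, all `n ≥ 1`, all
  `d`; `hasBoxLimit_znWilsonLoopLimit`, `zdExpect_le_znWilsonLoopLimit`, `znWilsonLoopLimit_le_one`,
  `znWilsonLoopLimit_nonneg`, `znWilsonLoopLimit_add_eq` (translation invariance), for `β ≥ 0`.
* `znWilsonLoopLimit_two_supermul_right` / `_left`: `⟨W_{R×(T₁+T₂)}⟩_β ≥ ⟨W_{R×T₁}⟩_β ⟨W_{R×T₂}⟩_β`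
  and the same in `R` (FV Prop. 6.3 (i) in the limit).
* `tanh_pow_le_znWilsonLoopLimit_two`: `(tanh β)^{RT} ≤ ⟨W_{R×T}⟩_β ≤ 1`.
* **`isingQuarkPotential_tendsto`** (FV Cor. 6.4): for `β > 0`,
  `-(1/T) log ⟨W_{γ_{R,T}}⟩_β → V_β(R) := isingQuarkPotential β x i j R` as `T → ∞`;
  `isingQuarkPotential_le_div` (the limit is the infimum, Fekete), and the bounds
  `0 ≤ V_β(R) ≤ -R log tanh β` (`isingQuarkPotential_nonneg`, `isingQuarkPotential_le`).
  (At `β = 0` the printed `⟨W_γ⟩_0 = 0` for non-degenerate loops and `V_0 ≡ +∞`; the real-valued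
  statement is therefore typed for `β > 0`.)

HONEST FRAMING: `ℤ₂` lattice gauge theory, free boundary conditions on `ℤ^d`; existence of the quark
potential says nothing about its growth (area vs perimeter law) and nothing about the Yang–Mills
mass gap (Clay) or `BalabanLadder.IR`.

## References

* M. P. Forsström, F. Viklund, arXiv:2502.19942, §1.1 (p. 3), Prop. 6.2, Prop. 6.3 (i), Cor. 6.4
  (p. 10). [ForsstromViklund2025currents]
* M. P. Forsström, J. Lenells, F. Viklund, AIHP 58 (2022), arXiv:2001.07453, Thm 4.1.
  [ForsstromLenellsViklund2022]
* R. Marra, S. Miracle-Solé, Comm. Math. Phys. 67 (1979) 233–240, p. 235. [MarraMiraclesole1979]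
* M. Fekete, Math. Z. 17 (1923) — Mathlib `Subadditive.tendsto_lim`.
-/

noncomputable section

open MeasureTheory Filter Finset
open scoped Topology
open Literature.Probability.LatticeModels Literature.MathematicalPhysics.QuantumLattice
open Literature.Barriers.QuantumFields (rootsOfUnityCircle mem_rootsOfUnityCircle znRep)

namespace Literature.MathematicalPhysics.QuantumFieldTheory

open AreaLaw

/-! ### Gluing of rectangle holonomies in an abelian gauge group -/

section Gluing

variable {d : ℕ} {Γ : Type*} [CommGroup Γ]

/-- Straight-path holonomies are multiplicative under concatenation:
`ℓ_k(y, m+n) = ℓ_k(y, m) · ℓ_k(y + m e_k, n)`. [folklore] -/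
private theorem line_add (U : ZdGaugeConfig d Γ) (k : Fin d) :
    ∀ (m n : ℕ) (y : Probability.LatticeModels.Site d),
      U.line k (m + n) y = U.line k m y * U.line k n (y + Pi.single k (m : ℤ))
  | 0, n, y => by simp [ZdGaugeConfig.line]
  | m + 1, n, y => by
    rw [Nat.add_right_comm, ZdGaugeConfig.line, ZdGaugeConfig.line, line_add U k m n, mul_assoc]
    congr 2
    rw [add_assoc, ← Pi.single_add]
    congr 2
    push_cast
    ring

/-- **Gluing two rectangles along the second direction** (the loop `γ₁ + γ₂` of FV Prop. 6.3 (i) for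
adjacent rectangles): in an abelian gauge group,
`hol(R × (T₁+T₂), x) = hol(R × T₁, x) · hol(R × T₂, x + T₁ eⱼ)` — the common edge is traversed in
opposite directions and cancels. [cite: ForsstromViklund2025currents, Prop. 6.3 (i) and proof of Cor. 6.4 (the loop γ₁ + γ₂, p. 10)] -/
theorem ZdGaugeConfig.rectangle_add_right (U : ZdGaugeConfig d Γ)
    (x : Probability.LatticeModels.Site d) (i j : Fin d) (R T₁ T₂ : ℕ) :
    U.rectangle x i j R (T₁ + T₂) =
      U.rectangle x i j R T₁ * U.rectangle (x + Pi.single j (T₁ : ℤ)) i j R T₂ := by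
  simp only [ZdGaugeConfig.rectangle, line_add, Nat.cast_add]
  have e1 : x + Pi.single i (R : ℤ) + Pi.single j (T₁ : ℤ) =
      x + Pi.single j (T₁ : ℤ) + Pi.single i (R : ℤ) := add_right_comm _ _ _
  have e2 : x + Pi.single j ((T₁ : ℤ) + (T₂ : ℤ)) =
      x + Pi.single j (T₁ : ℤ) + Pi.single j (T₂ : ℤ) := by
    rw [add_assoc, ← Pi.single_add]
  rw [e1, e2]
  simp only [mul_inv_rev]
  simp only [mul_comm, mul_left_comm, mul_assoc, mul_inv_cancel_left]

/-- **Gluing two rectangles along the first direction**: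
`hol((R₁+R₂) × T, x) = hol(R₁ × T, x) · hol(R₂ × T, x + R₁ eᵢ)`. [cite: ForsstromViklund2025currents, Prop. 6.3 (i) and proof of Cor. 6.4 (p. 10)] -/
theorem ZdGaugeConfig.rectangle_add_left (U : ZdGaugeConfig d Γ)
    (x : Probability.LatticeModels.Site d) (i j : Fin d) (R₁ R₂ T : ℕ) :
    U.rectangle x i j (R₁ + R₂) T =
      U.rectangle x i j R₁ T * U.rectangle (x + Pi.single i (R₁ : ℤ)) i j R₂ T := by
  simp only [ZdGaugeConfig.rectangle, line_add, Nat.cast_add]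
  have e1 : x + Pi.single j (T : ℤ) + Pi.single i (R₁ : ℤ) =
      x + Pi.single i (R₁ : ℤ) + Pi.single j (T : ℤ) := add_right_comm _ _ _
  have e2 : x + Pi.single i ((R₁ : ℤ) + (R₂ : ℤ)) =
      x + Pi.single i (R₁ : ℤ) + Pi.single i (R₂ : ℤ) := by
    rw [add_assoc, ← Pi.single_add]
  rw [e1, e2]
  simp only [mul_inv_rev]
  simp only [mul_comm, mul_left_comm, mul_assoc, mul_inv_cancel_left]

/-- Degenerate rectangles (`T = 0`) have trivial holonomy. [folklore] -/
private theorem rectangle_zero_right (U : ZdGaugeConfig d Γ)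
    (x : Probability.LatticeModels.Site d) (i j : Fin d) (R : ℕ) : U.rectangle x i j R 0 = 1 := by
  simp [ZdGaugeConfig.rectangle, ZdGaugeConfig.line]

/-- Degenerate rectangles (`R = 0`) have trivial holonomy. [folklore] -/
private theorem rectangle_zero_left (U : ZdGaugeConfig d Γ)
    (x : Probability.LatticeModels.Site d) (i j : Fin d) (T : ℕ) : U.rectangle x i j 0 T = 1 := by
  simp [ZdGaugeConfig.rectangle, ZdGaugeConfig.line]

/-- Reversing the orientation inverts the plaquette holonomy (abelian group). [folklore] -/
private theorem plaquette_swap (U : ZdGaugeConfig d Γ) (x : Probability.LatticeModels.Site d)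
    (i j : Fin d) : U.plaquette x j i = (U.plaquette x i j)⁻¹ := by
  simp only [ZdGaugeConfig.plaquette, mul_inv_rev, inv_inv]
  simp only [mul_comm, mul_left_comm, mul_assoc]

end Gluing

/-! ### `ℤ₂`-valued characters are real; `ℤ₂` Wilson loops multiply under gluing -/

section Z2

/-- An element of `ℤ₂ ⊂ U(1)` is `1` or `-1` as a complex number (`ρ(g) = e^{πig}`,
FV §1.1). [cite: ForsstromViklund2025currents, §1.1 (the representation ρ of ℤ₂, p. 3)] -/
theorem coe_rootsOfUnityCircle_two (z : ↥(rootsOfUnityCircle 2)) :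
    ((z : Circle) : ℂ) = 1 ∨ ((z : Circle) : ℂ) = -1 := by
  have hz : (z : Circle) ^ 2 = 1 := mem_rootsOfUnityCircle.1 z.2
  have hz' : ((z : Circle) : ℂ) * ((z : Circle) : ℂ) = 1 := by
    rw [← sq, ← Circle.coe_pow, hz, Circle.coe_one]
  exact mul_self_eq_one_iff.1 hz'

/-- The real part of an element of `ℤ₂ ⊂ U(1)` is `±1`. [cite: ForsstromViklund2025currents, §1.1 (p. 3)] -/
theorem re_coe_rootsOfUnityCircle_two (z : ↥(rootsOfUnityCircle 2)) :
    ((z : Circle) : ℂ).re = 1 ∨ ((z : Circle) : ℂ).re = -1 := by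
  rcases coe_rootsOfUnityCircle_two z with h | h <;> simp [h]

/-- The imaginary part of an element of `ℤ₂ ⊂ U(1)` vanishes. [cite: ForsstromViklund2025currents, §1.1 (p. 3)] -/
theorem im_coe_rootsOfUnityCircle_two (z : ↥(rootsOfUnityCircle 2)) :
    ((z : Circle) : ℂ).im = 0 := by
  rcases coe_rootsOfUnityCircle_two z with h | h <;> simp [h]

/-- Real parts are multiplicative on `ℤ₂`: `Re(z w) = Re z · Re w` (`W_{γ₁} W_{γ₂} = W_{γ₁+γ₂}` for
Ising gauge Wilson loops). [cite: ForsstromViklund2025currents, proof of Prop. 6.3 (W_{γ₁}W_{γ₂} = W_{γ₁+γ₂}, p. 10)] -/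
theorem re_coe_mul_rootsOfUnityCircle_two (z w : ↥(rootsOfUnityCircle 2)) :
    (((z * w : ↥(rootsOfUnityCircle 2)) : Circle) : ℂ).re =
      ((z : Circle) : ℂ).re * ((w : Circle) : ℂ).re := by
  rw [Subgroup.coe_mul, Circle.coe_mul, Complex.mul_re, im_coe_rootsOfUnityCircle_two,
    im_coe_rootsOfUnityCircle_two, mul_zero, sub_zero]

/-- `-1 ∈ ℤ₂`. [cite: ForsstromViklund2025currents, §1.1 (p. 3)] -/
theorem neg_one_mem_rootsOfUnityCircle_two : (-1 : Circle) ∈ rootsOfUnityCircle 2 := by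
  rw [mem_rootsOfUnityCircle, neg_one_sq]

/-- The generator `-1` of `ℤ₂ ⊂ U(1)`. [cite: ForsstromViklund2025currents, §1.1 (p. 3)] -/
def z2gen : ↥(rootsOfUnityCircle 2) := ⟨-1, neg_one_mem_rootsOfUnityCircle_two⟩

/-- `z2gen = -1` as a complex number. [cite: ForsstromViklund2025currents, §1.1 (p. 3)] -/
@[simp] theorem coe_z2gen : ((z2gen : Circle) : ℂ) = -1 := by
  simp [z2gen]

/-- Multiplication by the generator flips the sign of the real part. [cite: ForsstromViklund2025currents, §1.1 (p. 3)] -/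
theorem re_coe_z2gen_mul (z : ↥(rootsOfUnityCircle 2)) :
    (((z2gen * z : ↥(rootsOfUnityCircle 2)) : Circle) : ℂ).re = -((z : Circle) : ℂ).re := by
  rw [re_coe_mul_rootsOfUnityCircle_two, coe_z2gen, Complex.neg_re, Complex.one_re]; ring

variable {d : ℕ}

/-- **`ℤ₂` Wilson loops multiply under gluing** (second direction), pointwise in the configuration:
`W_{R×(T₁+T₂)}(x) = W_{R×T₁}(x) · W_{R×T₂}(x + T₁eⱼ)` — FV's `W_{γ₁} W_{γ₂} = W_{γ₁+γ₂}` for the two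
adjacent rectangles whose `ℤ₂`-sum is the big one. [cite: ForsstromViklund2025currents, proof of Prop. 6.3 and of Cor. 6.4 (p. 10)] -/
theorem zdWilsonLoop_z2_add_right (x : Probability.LatticeModels.Site d) (i j : Fin d) (R T₁ T₂ : ℕ)
    (U : ZdGaugeConfig d ↥(rootsOfUnityCircle 2)) :
    zdWilsonLoop (znRep 2) x i j R (T₁ + T₂) U =
      zdWilsonLoop (znRep 2) x i j R T₁ U *
        zdWilsonLoop (znRep 2) (x + Pi.single j (T₁ : ℤ)) i j R T₂ U := by
  simp only [zdWilsonLoop, ← charRep_znIncl, trace_charRep_re, znIncl_apply, Nat.cast_one, inv_one,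
    one_mul, ZdGaugeConfig.rectangle_add_right, re_coe_mul_rootsOfUnityCircle_two]

/-- **`ℤ₂` Wilson loops multiply under gluing** (first direction):
`W_{(R₁+R₂)×T}(x) = W_{R₁×T}(x) · W_{R₂×T}(x + R₁eᵢ)`. [cite: ForsstromViklund2025currents, proof of Prop. 6.3 and of Cor. 6.4 (p. 10)] -/
theorem zdWilsonLoop_z2_add_left (x : Probability.LatticeModels.Site d) (i j : Fin d) (R₁ R₂ T : ℕ)
    (U : ZdGaugeConfig d ↥(rootsOfUnityCircle 2)) :
    zdWilsonLoop (znRep 2) x i j (R₁ + R₂) T U =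
      zdWilsonLoop (znRep 2) x i j R₁ T U *
        zdWilsonLoop (znRep 2) (x + Pi.single i (R₁ : ℤ)) i j R₂ T U := by
  simp only [zdWilsonLoop, ← charRep_znIncl, trace_charRep_re, znIncl_apply, Nat.cast_one, inv_one,
    one_mul, ZdGaugeConfig.rectangle_add_left, re_coe_mul_rootsOfUnityCircle_two]

end Z2

/-! ### Degenerate loops and the plaquette (any abelian `Γ`) -/

section Plaquette

variable {d : ℕ} {Γ : Type*} [CommGroup Γ] [TopologicalSpace Γ] (φ : Γ →ₜ* Circle)

/-- A degenerate loop (`T = 0`) has `W ≡ 1`. [folklore] -/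
private theorem zdWilsonLoop_charRep_zero_right (x : Probability.LatticeModels.Site d) (i j : Fin d)
    (R : ℕ) : zdWilsonLoop (d := d) (charRep φ) x i j R 0 = fun _ => 1 := by
  funext U
  simp [zdWilsonLoop, rectangle_zero_right]

/-- A degenerate loop (`R = 0`) has `W ≡ 1`. [folklore] -/
private theorem zdWilsonLoop_charRep_zero_left (x : Probability.LatticeModels.Site d) (i j : Fin d)
    (T : ℕ) : zdWilsonLoop (d := d) (charRep φ) x i j 0 T = fun _ => 1 := by
  funext U
  simp [zdWilsonLoop, rectangle_zero_left]

/-- The `1 × 1` loop is the real part of the plaquette character: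
`W_{1×1}(x) = Re φ(U_p)`, `p = (x; i, j)` (FV: `W_{∂p}`). [cite: ForsstromViklund2025currents, proof of Prop. 6.3 (ii) (the loops ∂p, p. 10)] -/
theorem zdWilsonLoop_charRep_one_one (x : Probability.LatticeModels.Site d) (i j : Fin d)
    (U : ZdGaugeConfig d Γ) :
    zdWilsonLoop (charRep φ) x i j 1 1 U = ((φ (U.plaquette x i j) : Circle) : ℂ).re := by
  rw [PlaquetteLowerBound.zdWilsonLoop_one_one, trace_charRep_re, Nat.cast_one, inv_one, one_mul]

/-- The `1 × 1` loop is symmetric in the two directions (real part of the inverse holonomy).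
[cite: ForsstromViklund2025currents, proof of Prop. 6.3 (ii) (p. 10)] -/
theorem zdWilsonLoop_charRep_one_one_swap (x : Probability.LatticeModels.Site d) (i j : Fin d) :
    zdWilsonLoop (d := d) (charRep φ) x j i 1 1 = zdWilsonLoop (charRep φ) x i j 1 1 := by
  funext U
  rw [zdWilsonLoop_charRep_one_one, zdWilsonLoop_charRep_one_one, plaquette_swap, map_inv,
    Circle.coe_inv_eq_conj, Complex.conj_re]

end Plaquette

/-! ### The one-plaquette system of `ℤ₂`: mean `tanh β` -/

section SinglePlaquette

/-- Haar averaging on `ℤ₂` by the sign flip `z ↦ -z`: `∫ ψ(Re z) dz = (ψ(1) + ψ(-1))/2`.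
[cite: MarraMiraclesole1979, p. 235 (the one-link/one-plaquette evaluation th β)] -/
theorem integral_comp_re_rootsOfUnityCircle_two (ψ : ℝ → ℝ) :
    ∫ z, ψ (((z : Circle) : ℂ).re) ∂haarProbability ↥(rootsOfUnityCircle 2) = (ψ 1 + ψ (-1)) / 2 := by
  set μ := haarProbability ↥(rootsOfUnityCircle 2) with hμ
  have hflip : ∫ z, ψ (((z : Circle) : ℂ).re) ∂μ = ∫ z, ψ (-((z : Circle) : ℂ).re) ∂μ := by
    rw [← integral_mul_left_eq_self (fun z : ↥(rootsOfUnityCircle 2) => ψ (((z : Circle) : ℂ).re))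
      z2gen]
    refine integral_congr_ae (ae_of_all _ fun z => ?_)
    simp only [re_coe_z2gen_mul]
  have hconst : ∀ z : ↥(rootsOfUnityCircle 2),
      ψ (((z : Circle) : ℂ).re) + ψ (-((z : Circle) : ℂ).re) = ψ 1 + ψ (-1) := by
    intro z
    rcases re_coe_rootsOfUnityCircle_two z with h | h <;> simp [h, add_comm]
  have hsum : ∫ z, ψ (((z : Circle) : ℂ).re) ∂μ + ∫ z, ψ (-((z : Circle) : ℂ).re) ∂μ =
      ψ 1 + ψ (-1) := by
    rw [← integral_add (Integrable.of_finite) (Integrable.of_finite)]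
    simp_rw [hconst]
    rw [integral_const, probReal_univ, one_smul]
  linarith

/-- **The one-plaquette mean of Ising lattice gauge theory is `tanh β`**:
`∫_{ℤ₂} Re z e^{β Re z} dz / ∫_{ℤ₂} e^{β Re z} dz = (e^β - e^{-β})/(e^β + e^{-β}) = tanh β`.
[cite: MarraMiraclesole1979, p. 235 (⟨τ_Γ⟩ = (th β)^{|Γ|} at β_p = 0: independent ±1 variables)] -/
theorem singlePlaquetteMean_z2 (β : ℝ) :
    (∫ z, ((z : Circle) : ℂ).re * Real.exp (β * ((z : Circle) : ℂ).re)
        ∂haarProbability ↥(rootsOfUnityCircle 2)) /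
      (∫ z, Real.exp (β * ((z : Circle) : ℂ).re) ∂haarProbability ↥(rootsOfUnityCircle 2)) =
        Real.tanh β := by
  rw [integral_comp_re_rootsOfUnityCircle_two (fun t => t * Real.exp (β * t)),
    integral_comp_re_rootsOfUnityCircle_two (fun t => Real.exp (β * t)), Real.tanh_eq_sinh_div_cosh,
    Real.sinh_eq, Real.cosh_eq]
  simp only [mul_one, one_mul, mul_neg, neg_mul]
  rw [sub_eq_add_neg]

end SinglePlaquette

/-! ### The plaquette expectation in a region is at least `tanh β` (Ginibre, down to one plaquette) -/

section PlaquetteBound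

variable {d : ℕ}

/-- The corners of the plaquette `(x; i, j)`, `i ≠ j`, lie in the cube `B_{‖x‖_∞ + 1}`, i.e. the
plaquette belongs to `plaquettesIn B_{‖x‖_∞+1}` when `i < j`. [folklore] -/
private theorem plaq_mem_plaquettesIn_box (x : Probability.LatticeModels.Site d) {i j : Fin d}
    (hij : i < j) : ((x, i, j) : Plaq d) ∈ plaquettesIn (box d (Site.supNorm x + 1)) := by
  have hx : x ∈ box d (Site.supNorm x) := mem_box_iff_supNorm_le.2 le_rfl
  have hne : i ≠ j := hij.ne
  have h00 := add_single_add_single_mem_box (n := Site.supNorm x + 1) hx hne (s := 0) (t := 0)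
    le_rfl (by omega) le_rfl (by omega)
  have h10 := add_single_add_single_mem_box (n := Site.supNorm x + 1) hx hne (s := 1) (t := 0)
    zero_le_one (by omega) le_rfl (by omega)
  have h01 := add_single_add_single_mem_box (n := Site.supNorm x + 1) hx hne (s := 0) (t := 1)
    le_rfl (by omega) zero_le_one (by omega)
  have h11 := add_single_add_single_mem_box (n := Site.supNorm x + 1) hx hne (s := 1) (t := 1)
    zero_le_one (by omega) zero_le_one (by omega)
  simp only [Pi.single_zero, add_zero] at h00 h10 h01 h11
  exact Plaq.mem_plaquettesIn.2 ⟨h00, hij, h10, h01, h11⟩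

/-- **The periodised plaquette variable is Haar distributed** (torus form of
`PlaquetteLowerBound.integral_comp_plaquette_eq`): for the abelian theory `charRep φ` on the torus
`(ℤ/(2m+1)ℤ)^d`, a plaquette `(x; i, j)`, `i < j`, whose bonds are based in `B_m`, and continuous
`ψ`, `∫ ψ(Re φ(U_{π p})) dU = ∫_Γ ψ(Re φ(z)) dz` — transfer to `ℤ^d`
(`integral_torusLift_eq_integral_zdHaar`) and resample one bond of the plaquette. [folklore] -/
private theorem integral_comp_rePlaquetteChar_eq {Γ : Type*} [CommGroup Γ] [TopologicalSpace Γ]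
    [IsTopologicalGroup Γ] [CompactSpace Γ] [SecondCountableTopology Γ] [MeasurableSpace Γ]
    [BorelSpace Γ] (φ : Γ →ₜ* Circle) {m : ℕ}
    {x : Probability.LatticeModels.Site d} {i j : Fin d} (hij : i < j)
    (hbonds : ∀ e ∈ Plaq.bonds ((x, i, j) : Plaq d), e.1 ∈ box d m) (ψ : ℝ → ℝ) (hψ : Continuous ψ) :
    ∫ U, ψ (reChar (abelianPlaquetteChars φ d (2 * m + 1)
        (Torus.proj (2 * m + 1) x, ⟨(i, j), hij⟩)) U)
        ∂(Measure.pi fun _ : Edge d (2 * m + 1) => haarProbability Γ) =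
      ∫ z, ψ (((φ z : Circle) : ℂ).re) ∂haarProbability Γ := by
  have hre : ∀ U : GaugeConfig d (2 * m + 1) Γ,
      reChar (abelianPlaquetteChars φ d (2 * m + 1) (Torus.proj (2 * m + 1) x, ⟨(i, j), hij⟩)) U =
        ((φ (ZdGaugeConfig.plaquette (torusLift (2 * m + 1) U) x i j) : Circle) : ℂ).re := by
    intro U
    simp only [reChar, abelianPlaquetteChars_apply, plaquette_torusLift]
  have hpc : Continuous fun V : ZdGaugeConfig d Γ => ZdGaugeConfig.plaquette V x i j :=
    continuous_plaquette x i j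
  have hGc : Continuous fun V : ZdGaugeConfig d Γ =>
      ψ (((φ (ZdGaugeConfig.plaquette V x i j) : Circle) : ℂ).re) :=
    hψ.comp (Complex.continuous_re.comp (continuous_subtype_val.comp ((map_continuous φ).comp hpc)))
  have hGdep : DependsOn (fun V : ZdGaugeConfig d Γ =>
      ψ (((φ (ZdGaugeConfig.plaquette V x i j) : Circle) : ℂ).re))
      ((Plaq.bonds ((x, i, j) : Plaq d) : Finset (ZdEdge d)) : Set (ZdEdge d)) := by
    intro U V h
    simp only
    rw [show ZdGaugeConfig.plaquette U x i j = ZdGaugeConfig.plaquette V x i j from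
      dependsOn_plaquette_bonds ((x, i, j) : Plaq d) h]
  have hinj : Set.InjOn (torusEdge (d := d) (2 * m + 1))
      ((Plaq.bonds ((x, i, j) : Plaq d) : Finset (ZdEdge d)) : Set (ZdEdge d)) :=
    torusEdge_injOn (le_refl (2 * m)) hbonds
  simp_rw [hre]
  rw [integral_torusLift_eq_integral_zdHaar hinj hGc.measurable hGdep]
  have hc : Continuous fun g : Γ => ψ (((φ g : Circle) : ℂ).re) :=
    hψ.comp (Complex.continuous_re.comp (continuous_subtype_val.comp (map_continuous φ)))
  exact PlaquetteLowerBound.integral_comp_plaquette_eq hc x hij.ne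

/-- **The free-boundary plaquette expectation of the `ℤ₂` theory is at least `tanh β`**: for
`β ≥ 0`, `i < j` and every region `Λ` containing the plaquette `p = (x; i, j)`,
`tanh β ≤ ⟨W_{∂p}⟩_{Λ,β}`. Transfer to the torus Ginibre model (`zdExpect_charRep_eq_ginibreExpect`),
lower the couplings to `β` on the one periodised plaquette and `0` elsewhere (Ginibre's inequality
through the square-root extension `ℤ₂^E ↪ ℤ₄^E`), and evaluate the one-plaquette system: its
plaquette variable is Haar distributed (`PlaquetteLowerBound.integral_comp_plaquette_eq`), with
mean `tanh β` (`singlePlaquetteMean_z2`). (FV Prop. 6.2 proves `E_{N,β}[W_γ] > 0` by the current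
expansion; the quantitative plaquette bound is the Griffiths route.) [cite: ForsstromViklund2025currents, Prop. 6.2 and Prop. 6.3 (ii) (positivity and monotonicity, p. 10)] -/
theorem tanh_le_zdExpect_z2_plaquette {β : ℝ} (hβ : 0 ≤ β) {Λ : Finset (Probability.LatticeModels.Site d)}
    {x : Probability.LatticeModels.Site d} {i j : Fin d} (hij : i < j)
    (hp : ((x, i, j) : Plaq d) ∈ plaquettesIn Λ) :
    Real.tanh β ≤ zdExpect (znRep 2) β Λ (zdWilsonLoop (znRep 2) x i j 1 1) := by
  classical
  -- a cube containing the region and the plaquette bonds; torus of side `2m + 1 ≥ 2`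
  obtain ⟨m₀, hm₀, hx₀⟩ := exists_subset_box_and_loopEdges Λ x hij.ne 1 1
  set m := m₀ + 1 with hm
  have hΛ : Λ ⊆ box d m := hm₀.trans (box_mono d (Nat.le_succ _))
  have hbonds : ∀ e ∈ Plaq.bonds ((x, i, j) : Plaq d), e.1 ∈ box d m := fun e he =>
    hΛ (Plaq.fst_mem_of_mem_bonds hp he)
  set φ := znIncl 2 with hφ
  set μ : Measure (GaugeConfig d (2 * m + 1) ↥(rootsOfUnityCircle 2)) :=
    Measure.pi fun _ : Edge d (2 * m + 1) => haarProbability ↥(rootsOfUnityCircle 2) with hμ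
  set χ := abelianPlaquetteChars φ d (2 * m + 1) with hχ
  set q₀ : Plaquette d (2 * m + 1) := (Torus.proj (2 * m + 1) x, ⟨(i, j), hij⟩) with hq₀
  -- the plaquette observable on the torus
  set F : ZdGaugeConfig d ↥(rootsOfUnityCircle 2) → ℝ := zdWilsonLoop (znRep 2) x i j 1 1 with hF
  have hFc : Continuous F := continuous_zdWilsonLoop (znRep 2) (Barriers.QuantumFields.continuous_znRep 2) x i j 1 1
  have hFdep : DependsOn F ((Plaq.bonds ((x, i, j) : Plaq d) : Finset (ZdEdge d)) : Set (ZdEdge d)) := by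
    intro U V h
    simp only [hF, ← charRep_znIncl, zdWilsonLoop_charRep_one_one]
    rw [show ZdGaugeConfig.plaquette U x i j = ZdGaugeConfig.plaquette V x i j from
      dependsOn_plaquette_bonds ((x, i, j) : Plaq d) h]
  have hFtorus : F ∘ torusLift (2 * m + 1) = reChar (χ q₀) := by
    funext U
    simp only [hF, Function.comp_apply, ← charRep_znIncl, zdWilsonLoop_charRep_one_one,
      plaquette_torusLift, hχ, hφ, reChar, abelianPlaquetteChars_apply, hq₀, znIncl_apply]
  -- transfer
  have htransfer : zdExpect (znRep 2) β Λ F = ginibreExpect μ χ (regionCoupling β Λ (2 * m + 1)) (reChar (χ q₀)) := by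
    rw [← hFtorus, ← charRep_znIncl]
    exact zdExpect_charRep_eq_ginibreExpect φ β (le_refl (2 * m)) hΛ
      hFc hFdep hbonds
  rw [htransfer]
  -- lower the couplings to the single plaquette `q₀`
  set J' : Plaquette d (2 * m + 1) → ℝ := fun q => if q = q₀ then β else 0 with hJ'
  have hJ'0 : ∀ q, 0 ≤ J' q := fun q => by
    simp only [hJ']; split_ifs <;> [exact hβ; exact le_rfl]
  have hmult : 1 ≤ regionMultiplicity Λ (2 * m + 1) q₀ := by
    unfold regionMultiplicity
    refine Finset.card_pos.2 ⟨(x, i, j), Finset.mem_filter.2 ⟨hp, ?_⟩⟩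
    simp [hq₀]
  have hJ'le : ∀ q, J' q ≤ regionCoupling β Λ (2 * m + 1) q := by
    intro q
    simp only [hJ']
    split_ifs with hq
    · subst hq
      unfold regionCoupling
      have : (1 : ℝ) ≤ regionMultiplicity Λ (2 * m + 1) q₀ := by exact_mod_cast hmult
      nlinarith
    · exact regionCoupling_nonneg hβ Λ _ q
  have h2 := rootsOfUnityCircle_le_two_mul 2
  have hmono : ginibreExpect μ χ J' (reChar (χ q₀)) ≤
      ginibreExpect μ χ (regionCoupling β Λ (2 * m + 1)) (reChar (χ q₀)) :=
    GinibreSqrtExt.ginibreExpect_reChar_mono_of_sqrtExt μ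
      (MonoidHom.compLeft (Subgroup.inclusion h2) (Edge d (2 * m + 1)))
      (Subgroup.inclusion_injective h2).comp_left
      (GinibreSqrtExt.exists_mul_self_eq_compLeft _ (exists_mul_self_eq_inclusion_rootsOfUnityCircle 2))
      χ (χ q₀) (abelianPlaquetteChars (znIncl (2 * 2)) d (2 * m + 1))
      (abelianPlaquetteChars (znIncl (2 * 2)) d (2 * m + 1) q₀)
      (fun _ _ => rfl) (fun _ => rfl) hJ'0 hJ'le
  refine le_trans (le_of_eq ?_) hmono
  -- evaluate the one-plaquette system
  have hH : ∀ U, ginibreHamiltonian χ J' U = β * reChar (χ q₀) U := by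
    intro U
    simp only [ginibreHamiltonian, hJ', ite_mul, zero_mul, Finset.sum_ite_eq', Finset.mem_univ,
      if_true]
  have hw : ∀ U, ginibreWeight χ J' U = Real.exp (β * reChar (χ q₀) U) := fun U => by
    rw [ginibreWeight, hH]
  rw [ginibreExpect]
  simp_rw [hw, hχ, hq₀]
  rw [integral_comp_rePlaquetteChar_eq φ hij hbonds (fun t => t * Real.exp (β * t))
      (continuous_id.mul (Real.continuous_exp.comp (continuous_const.mul continuous_id))),
    integral_comp_rePlaquetteChar_eq φ hij hbonds (fun t => Real.exp (β * t))
      (Real.continuous_exp.comp (continuous_const.mul continuous_id))]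
  simp only [hφ, znIncl_apply]
  exact (singlePlaquetteMean_z2 β).symm

/-- The plaquette bound for either orientation: `tanh β ≤ ⟨W_{1×1}(x; i, j)⟩_{Λ,β}` for `i ≠ j` and
every region containing the plaquette. [cite: ForsstromViklund2025currents, Prop. 6.2 and Prop. 6.3 (ii) (p. 10)] -/
theorem tanh_le_zdExpect_z2_plaquette' {β : ℝ} (hβ : 0 ≤ β) {Λ : Finset (Probability.LatticeModels.Site d)}
    {x : Probability.LatticeModels.Site d} {i j : Fin d} (hij : i ≠ j)
    (hp : ((x, min i j, max i j) : Plaq d) ∈ plaquettesIn Λ) :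
    Real.tanh β ≤ zdExpect (znRep 2) β Λ (zdWilsonLoop (znRep 2) x i j 1 1) := by
  rcases lt_or_gt_of_ne hij with h | h
  · rw [min_eq_left h.le, max_eq_right h.le] at hp
    exact tanh_le_zdExpect_z2_plaquette hβ h hp
  · rw [min_eq_right h.le, max_eq_left h.le] at hp
    rw [← charRep_znIncl, ← zdWilsonLoop_charRep_one_one_swap, charRep_znIncl]
    exact tanh_le_zdExpect_z2_plaquette hβ h hp

end PlaquetteBound

/-! ### The infinite-volume `ℤ_n` Wilson loop `⟨W_γ⟩_β` -/

section Limit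

variable {d : ℕ}

/-- **The infinite-volume Wilson loop expectation of the `ℤ_n` lattice gauge theory** with free
boundary conditions, `⟨W_γ⟩_β := lim_{N → ∞} E_{β,N}[W_γ]` (FV §1.1; FLV (4.1)), for the rectangle
`γ = R × T` based at `x` in the `(i, j)` plane: the box limit of the tree's free-boundary
expectations (`boxLim`; it IS the limit for `β ≥ 0` by `hasBoxLimit_znWilsonLoopLimit`, and a junk
value otherwise). [cite: ForsstromViklund2025currents, §1.1 (definition of ⟨W_γ⟩_β, p. 3)] -/
def znWilsonLoopLimit (n : ℕ) (β : ℝ) (x : Probability.LatticeModels.Site d) (i j : Fin d)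
    (R T : ℕ) : ℝ :=
  boxLim fun Λ => zdExpect (znRep n) β Λ (zdWilsonLoop (znRep n) x i j R T)

variable {n : ℕ} [NeZero n]

/-- `⟨W_γ⟩_β` is the limit of the cube expectations (`β ≥ 0`, `i ≠ j`; FLV Thm 4.1 (i)).
[cite: ForsstromViklund2025currents, §1.1 (p. 3)] -/
theorem hasBoxLimit_znWilsonLoopLimit {β : ℝ} (hβ : 0 ≤ β) (x : Probability.LatticeModels.Site d)
    {i j : Fin d} (hij : i ≠ j) (R T : ℕ) :
    HasBoxLimit (fun Λ => zdExpect (znRep n) β Λ (zdWilsonLoop (znRep n) x i j R T))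
      (znWilsonLoopLimit n β x i j R T) := by
  obtain ⟨w, hw, -, -⟩ := hasBoxLimit_zdExpect_zn_wilsonLoop (n := n) hβ x hij R T
  exact hasBoxLimit_boxLim ⟨w, hw⟩

/-- Every region expectation is below the limit: `⟨W_γ⟩_{Λ,β} ≤ ⟨W_γ⟩_β` (monotone limit).
[cite: ForsstromLenellsViklund2022, Thm 4.1 proof, eq. (4.3) (p. 15)] -/
theorem zdExpect_le_znWilsonLoopLimit {β : ℝ} (hβ : 0 ≤ β) (Λ : Finset (Probability.LatticeModels.Site d))
    (x : Probability.LatticeModels.Site d) {i j : Fin d} (hij : i ≠ j) (R T : ℕ) :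
    zdExpect (znRep n) β Λ (zdWilsonLoop (znRep n) x i j R T) ≤ znWilsonLoopLimit n β x i j R T := by
  obtain ⟨w, hw, hle, -⟩ := hasBoxLimit_zdExpect_zn_wilsonLoop (n := n) hβ x hij R T
  rw [znWilsonLoopLimit, boxLim_eq_of_hasBoxLimit hw]
  exact hle Λ

/-- `⟨W_γ⟩_β ≤ 1`. [cite: ForsstromViklund2025currents, §1.1 (p. 3)] -/
theorem znWilsonLoopLimit_le_one {β : ℝ} (hβ : 0 ≤ β) (x : Probability.LatticeModels.Site d)
    {i j : Fin d} (hij : i ≠ j) (R T : ℕ) : znWilsonLoopLimit n β x i j R T ≤ 1 := by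
  obtain ⟨w, hw, -, h1⟩ := hasBoxLimit_zdExpect_zn_wilsonLoop (n := n) hβ x hij R T
  rw [znWilsonLoopLimit, boxLim_eq_of_hasBoxLimit hw]
  exact h1

/-- `0 ≤ ⟨W_γ⟩_β` (Griffiths' first inequality in the limit). [cite: ForsstromViklund2025currents, Prop. 6.2 (p. 10)] -/
theorem znWilsonLoopLimit_nonneg {β : ℝ} (hβ : 0 ≤ β) (x : Probability.LatticeModels.Site d)
    {i j : Fin d} (hij : i ≠ j) (R T : ℕ) : 0 ≤ znWilsonLoopLimit n β x i j R T :=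
  (zdExpect_zn_wilsonLoop_nonneg hβ ∅ x hij R T).trans (zdExpect_le_znWilsonLoopLimit hβ ∅ x hij R T)

/-- **Translation invariance of `⟨W_γ⟩_β`** (FLV Thm 4.1 (ii)): `⟨W_γ(x + a)⟩_β = ⟨W_γ(x)⟩_β`.
[cite: ForsstromLenellsViklund2022, Thm 4.1 (ii) (p. 14)] -/
theorem znWilsonLoopLimit_add_eq {β : ℝ} (hβ : 0 ≤ β) (x a : Probability.LatticeModels.Site d)
    {i j : Fin d} (hij : i ≠ j) (R T : ℕ) :
    znWilsonLoopLimit n β (x + a) i j R T = znWilsonLoopLimit n β x i j R T :=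
  boxLimit_zdExpect_zn_wilsonLoop_eq_of_translate hβ hij (hasBoxLimit_znWilsonLoopLimit hβ x hij R T)
    a (hasBoxLimit_znWilsonLoopLimit hβ (x + a) hij R T)

omit [NeZero n] in
/-- Expectations of the constant `1` are `1` (the free-boundary theory is a probability measure).
[folklore] -/
private theorem zdExpect_const_one (β : ℝ) (Λ : Finset (Probability.LatticeModels.Site d)) :
    zdExpect (znRep n) β Λ (fun _ : ZdGaugeConfig d ↥(rootsOfUnityCircle n) => (1 : ℝ)) = 1 := by
  haveI := isProbabilityMeasure_zdWilsonMeasure (znRep n) (Barriers.QuantumFields.continuous_znRep n) β Λ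
  rw [zdExpect, integral_const, probReal_univ, one_smul]

/-- Degenerate loops: `⟨W_{R×0}⟩_β = 1`. [folklore] -/
private theorem znWilsonLoopLimit_zero_right {β : ℝ} (hβ : 0 ≤ β) (x : Probability.LatticeModels.Site d)
    {i j : Fin d} (hij : i ≠ j) (R : ℕ) : znWilsonLoopLimit n β x i j R 0 = 1 := by
  have h := hasBoxLimit_znWilsonLoopLimit (n := n) hβ x hij R 0
  rw [← charRep_znIncl, zdWilsonLoop_charRep_zero_right, charRep_znIncl] at h
  simp_rw [zdExpect_const_one] at h
  exact tendsto_nhds_unique h tendsto_const_nhds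

/-- Degenerate loops: `⟨W_{0×T}⟩_β = 1`. [folklore] -/
private theorem znWilsonLoopLimit_zero_left {β : ℝ} (hβ : 0 ≤ β) (x : Probability.LatticeModels.Site d)
    {i j : Fin d} (hij : i ≠ j) (T : ℕ) : znWilsonLoopLimit n β x i j 0 T = 1 := by
  have h := hasBoxLimit_znWilsonLoopLimit (n := n) hβ x hij 0 T
  rw [← charRep_znIncl, zdWilsonLoop_charRep_zero_left, charRep_znIncl] at h
  simp_rw [zdExpect_const_one] at h
  exact tendsto_nhds_unique h tendsto_const_nhds

end Limit

/-! ### Supermultiplicativity of `⟨W_{R×T}⟩_β` (FV Prop. 6.3 (i) in infinite volume) -/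

section Supermultiplicative

variable {d : ℕ}

/-- **Supermultiplicativity in `T`** (the subadditivity of `T ↦ -log⟨W_{γ_{R,T}}⟩_β` in FV's proof of
Cor. 6.4): `⟨W_{R×T₁}⟩_β ⟨W_{R×T₂}⟩_β ≤ ⟨W_{R×(T₁+T₂)}⟩_β` for the Ising gauge theory, `β ≥ 0` —
Griffiths II for the two adjacent loops in every cube (`zdExpect_zn_wilsonLoop_mul_ge` with the
gluing identity), translation invariance for the second factor, and passage to the limit.
[cite: ForsstromViklund2025currents, Prop. 6.3 (i) and proof of Cor. 6.4 (p. 10)] -/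
theorem znWilsonLoopLimit_two_supermul_right {β : ℝ} (hβ : 0 ≤ β) (x : Probability.LatticeModels.Site d)
    {i j : Fin d} (hij : i ≠ j) (R T₁ T₂ : ℕ) :
    znWilsonLoopLimit 2 β x i j R T₁ * znWilsonLoopLimit 2 β x i j R T₂ ≤
      znWilsonLoopLimit 2 β x i j R (T₁ + T₂) := by
  set a : Probability.LatticeModels.Site d := Pi.single j (T₁ : ℤ) with ha
  have h1 := hasBoxLimit_znWilsonLoopLimit (n := 2) hβ x hij R T₁
  have h2 : HasBoxLimit (fun Λ => zdExpect (znRep 2) β Λ (zdWilsonLoop (znRep 2) (x + a) i j R T₂))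
      (znWilsonLoopLimit 2 β x i j R T₂) :=
    hasBoxLimit_zdExpect_zn_wilsonLoop_translate hβ hij (hasBoxLimit_znWilsonLoopLimit hβ x hij R T₂) a
  have h12 := hasBoxLimit_znWilsonLoopLimit (n := 2) hβ x hij R (T₁ + T₂)
  refine le_of_tendsto_of_tendsto' (h1.mul h2) h12 fun N => ?_
  change zdExpect (znRep 2) β (box d N) (zdWilsonLoop (znRep 2) x i j R T₁) *
      zdExpect (znRep 2) β (box d N) (zdWilsonLoop (znRep 2) (x + a) i j R T₂) ≤
    zdExpect (znRep 2) β (box d N) (zdWilsonLoop (znRep 2) x i j R (T₁ + T₂))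
  rw [show zdWilsonLoop (d := d) (znRep 2) x i j R (T₁ + T₂) = fun U =>
      zdWilsonLoop (znRep 2) x i j R T₁ U * zdWilsonLoop (znRep 2) (x + a) i j R T₂ U from
    funext fun U => zdWilsonLoop_z2_add_right x i j R T₁ T₂ U]
  exact zdExpect_zn_wilsonLoop_mul_ge hβ _ x (x + a) hij hij R T₁ R T₂

/-- **Supermultiplicativity in `R`**: `⟨W_{R₁×T}⟩_β ⟨W_{R₂×T}⟩_β ≤ ⟨W_{(R₁+R₂)×T}⟩_β` (`β ≥ 0`).
[cite: ForsstromViklund2025currents, Prop. 6.3 (i) and proof of Cor. 6.4 (p. 10)] -/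
theorem znWilsonLoopLimit_two_supermul_left {β : ℝ} (hβ : 0 ≤ β) (x : Probability.LatticeModels.Site d)
    {i j : Fin d} (hij : i ≠ j) (R₁ R₂ T : ℕ) :
    znWilsonLoopLimit 2 β x i j R₁ T * znWilsonLoopLimit 2 β x i j R₂ T ≤
      znWilsonLoopLimit 2 β x i j (R₁ + R₂) T := by
  set a : Probability.LatticeModels.Site d := Pi.single i (R₁ : ℤ) with ha
  have h1 := hasBoxLimit_znWilsonLoopLimit (n := 2) hβ x hij R₁ T
  have h2 : HasBoxLimit (fun Λ => zdExpect (znRep 2) β Λ (zdWilsonLoop (znRep 2) (x + a) i j R₂ T))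
      (znWilsonLoopLimit 2 β x i j R₂ T) :=
    hasBoxLimit_zdExpect_zn_wilsonLoop_translate hβ hij (hasBoxLimit_znWilsonLoopLimit hβ x hij R₂ T) a
  have h12 := hasBoxLimit_znWilsonLoopLimit (n := 2) hβ x hij (R₁ + R₂) T
  refine le_of_tendsto_of_tendsto' (h1.mul h2) h12 fun N => ?_
  change zdExpect (znRep 2) β (box d N) (zdWilsonLoop (znRep 2) x i j R₁ T) *
      zdExpect (znRep 2) β (box d N) (zdWilsonLoop (znRep 2) (x + a) i j R₂ T) ≤
    zdExpect (znRep 2) β (box d N) (zdWilsonLoop (znRep 2) x i j (R₁ + R₂) T)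
  rw [show zdWilsonLoop (d := d) (znRep 2) x i j (R₁ + R₂) T = fun U =>
      zdWilsonLoop (znRep 2) x i j R₁ T U * zdWilsonLoop (znRep 2) (x + a) i j R₂ T U from
    funext fun U => zdWilsonLoop_z2_add_left x i j R₁ R₂ T U]
  exact zdExpect_zn_wilsonLoop_mul_ge hβ _ x (x + a) hij hij R₁ T R₂ T

/-- **Positivity, quantitatively: `(tanh β)^{RT} ≤ ⟨W_{R×T}⟩_β`** for the Ising gauge theory,
`β ≥ 0`, `i ≠ j` — supermultiplicativity in both directions down to single plaquettes
(`tanh_le_zdExpect_z2_plaquette'`). In particular `⟨W_γ⟩_β > 0` for `β > 0` (FV Prop. 6.2 in the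
limit), so that `log⟨W_{γ_{R,T}}⟩_β` in Cor. 6.4 is meaningful. [cite: ForsstromViklund2025currents, Prop. 6.2 with Prop. 6.3 (i) (p. 10)] -/
theorem tanh_pow_le_znWilsonLoopLimit_two {β : ℝ} (hβ : 0 ≤ β) (x : Probability.LatticeModels.Site d)
    {i j : Fin d} (hij : i ≠ j) (R T : ℕ) :
    Real.tanh β ^ (R * T) ≤ znWilsonLoopLimit 2 β x i j R T := by
  have ht0 : 0 ≤ Real.tanh β := by
    rw [Real.tanh_eq_sinh_div_cosh]
    exact div_nonneg (Real.sinh_nonneg_iff.2 hβ) (Real.cosh_pos β).le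
  -- one plaquette, then a column `R × 1`, then the rectangle
  have h11 : ∀ y : Probability.LatticeModels.Site d, Real.tanh β ≤ znWilsonLoopLimit 2 β y i j 1 1 := by
    intro y
    refine le_trans ?_ (zdExpect_le_znWilsonLoopLimit hβ (box d (Site.supNorm y + 1)) y hij 1 1)
    exact tanh_le_zdExpect_z2_plaquette' hβ hij (plaq_mem_plaquettesIn_box y (min_lt_max.2 hij))
  have hR1 : ∀ R : ℕ, Real.tanh β ^ R ≤ znWilsonLoopLimit 2 β x i j R 1 := by
    intro R
    induction R with
    | zero => rw [pow_zero, znWilsonLoopLimit_zero_left hβ x hij]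
    | succ R ih =>
      calc Real.tanh β ^ (R + 1) = Real.tanh β ^ R * Real.tanh β := pow_succ _ _
        _ ≤ znWilsonLoopLimit 2 β x i j R 1 * znWilsonLoopLimit 2 β x i j 1 1 :=
          mul_le_mul ih ((h11 (x + Pi.single i (R : ℤ))).trans_eq
            (znWilsonLoopLimit_add_eq hβ x _ hij 1 1)) ht0
            ((pow_nonneg ht0 R).trans ih)
        _ ≤ znWilsonLoopLimit 2 β x i j (R + 1) 1 := znWilsonLoopLimit_two_supermul_left hβ x hij R 1 1
  induction T with
  | zero => rw [mul_zero, pow_zero, znWilsonLoopLimit_zero_right hβ x hij]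
  | succ T ih =>
    calc Real.tanh β ^ (R * (T + 1)) = Real.tanh β ^ (R * T) * Real.tanh β ^ R := by
          rw [mul_add, mul_one, pow_add]
      _ ≤ znWilsonLoopLimit 2 β x i j R T * znWilsonLoopLimit 2 β x i j R 1 :=
        mul_le_mul ih (hR1 R) (pow_nonneg ht0 R) ((pow_nonneg ht0 _).trans ih)
      _ ≤ znWilsonLoopLimit 2 β x i j R (T + 1) := znWilsonLoopLimit_two_supermul_right hβ x hij R T 1

/-- `⟨W_{R×T}⟩_β > 0` for `β > 0` (FV Prop. 6.2 in infinite volume). [cite: ForsstromViklund2025currents, Prop. 6.2 (p. 10)] -/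
theorem znWilsonLoopLimit_two_pos {β : ℝ} (hβ : 0 < β) (x : Probability.LatticeModels.Site d)
    {i j : Fin d} (hij : i ≠ j) (R T : ℕ) : 0 < znWilsonLoopLimit 2 β x i j R T := by
  have ht : 0 < Real.tanh β := by
    rw [Real.tanh_eq_sinh_div_cosh]
    exact div_pos (Real.sinh_pos_iff.2 hβ) (Real.cosh_pos β)
  exact (pow_pos ht _).trans_le (tanh_pow_le_znWilsonLoopLimit_two hβ.le x hij R T)

end Supermultiplicative

/-! ### Forsström–Viklund Corollary 6.4: the quark potential exists (Fekete) -/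

section QuarkPotential

variable {d : ℕ}

/-- **The quark potential of Ising lattice gauge theory**,
`V_β(R) := lim_{T → ∞} -(1/T) log ⟨W_{γ_{R,T}}⟩_β` (FV Cor. 6.4), for rectangles based at `x` in the
`(i, j)` plane: the `limUnder` of the sequence (it IS the limit for `β > 0`, `i ≠ j`, by
`isingQuarkPotential_tendsto`). [cite: ForsstromViklund2025currents, Cor. 6.4 (p. 10)] -/
def isingQuarkPotential (β : ℝ) (x : Probability.LatticeModels.Site d) (i j : Fin d) (R : ℕ) : ℝ :=
  limUnder atTop fun T : ℕ => -Real.log (znWilsonLoopLimit 2 β x i j R T) / T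

/-- **FV's subadditivity**: for `β > 0`, `T ↦ -log⟨W_{γ_{R,T}}⟩_β` is subadditive (from Prop. 6.3 (i)
in the limit, `znWilsonLoopLimit_two_supermul_right`, and positivity). [cite: ForsstromViklund2025currents, proof of Cor. 6.4 (p. 10)] -/
theorem subadditive_neg_log_znWilsonLoopLimit_two {β : ℝ} (hβ : 0 < β)
    (x : Probability.LatticeModels.Site d) {i j : Fin d} (hij : i ≠ j) (R : ℕ) :
    Subadditive fun T : ℕ => -Real.log (znWilsonLoopLimit 2 β x i j R T) := by
  intro T₁ T₂
  have h1 := znWilsonLoopLimit_two_pos hβ x hij R T₁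
  have h2 := znWilsonLoopLimit_two_pos hβ x hij R T₂
  have hle := znWilsonLoopLimit_two_supermul_right hβ.le x hij R T₁ T₂
  have hlog := Real.log_le_log (mul_pos h1 h2) hle
  rw [Real.log_mul h1.ne' h2.ne'] at hlog
  linarith

/-- **Forsström–Viklund 2025, Corollary 6.4 (existence of the quark potential).** For Ising lattice
gauge theory on `ℤ^d` (free boundary conditions, infinite-volume Wilson loops `⟨W_γ⟩_β`) at any
`β > 0`, every base point `x`, plane `i ≠ j` and width `R`:
`-(1/T) log ⟨W_{γ_{R,T}}⟩_β → V_β(R)` as `T → ∞`. Printed proof: subadditivity (Prop. 6.3 (i)) and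
Fekete's lemma (`Subadditive.tendsto_lim`; the sequence `u_T/T ≥ 0` is bounded below since
`⟨W⟩_β ≤ 1`). [cite: ForsstromViklund2025currents, Cor. 6.4 (p. 10)] -/
theorem isingQuarkPotential_tendsto {β : ℝ} (hβ : 0 < β) (x : Probability.LatticeModels.Site d)
    {i j : Fin d} (hij : i ≠ j) (R : ℕ) :
    Tendsto (fun T : ℕ => -Real.log (znWilsonLoopLimit 2 β x i j R T) / T) atTop
      (𝓝 (isingQuarkPotential β x i j R)) := by
  have hsub := subadditive_neg_log_znWilsonLoopLimit_two hβ x hij R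
  have hbdd : BddBelow (Set.range fun T : ℕ => -Real.log (znWilsonLoopLimit 2 β x i j R T) / T) := by
    refine ⟨0, ?_⟩
    rintro _ ⟨T, rfl⟩
    refine div_nonneg ?_ (Nat.cast_nonneg T)
    rw [neg_nonneg]
    exact Real.log_nonpos (znWilsonLoopLimit_nonneg hβ.le x hij R T)
      (znWilsonLoopLimit_le_one hβ.le x hij R T)
  have h := hsub.tendsto_lim hbdd
  rw [isingQuarkPotential, h.limUnder_eq]
  exact h

/-- **The limit is the infimum** (Fekete): `V_β(R) ≤ -(1/T) log⟨W_{γ_{R,T}}⟩_β` for every `T ≥ 1`.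
[cite: ForsstromViklund2025currents, Cor. 6.4 (p. 10)] -/
theorem isingQuarkPotential_le_div {β : ℝ} (hβ : 0 < β) (x : Probability.LatticeModels.Site d)
    {i j : Fin d} (hij : i ≠ j) (R : ℕ) {T : ℕ} (hT : T ≠ 0) :
    isingQuarkPotential β x i j R ≤ -Real.log (znWilsonLoopLimit 2 β x i j R T) / T := by
  have hsub := subadditive_neg_log_znWilsonLoopLimit_two hβ x hij R
  have hbdd : BddBelow (Set.range fun T : ℕ => -Real.log (znWilsonLoopLimit 2 β x i j R T) / T) := by
    refine ⟨0, ?_⟩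
    rintro _ ⟨T, rfl⟩
    refine div_nonneg ?_ (Nat.cast_nonneg T)
    rw [neg_nonneg]
    exact Real.log_nonpos (znWilsonLoopLimit_nonneg hβ.le x hij R T)
      (znWilsonLoopLimit_le_one hβ.le x hij R T)
  have h := hsub.tendsto_lim hbdd
  have hV : isingQuarkPotential β x i j R = hsub.lim := by
    rw [isingQuarkPotential, h.limUnder_eq]
  rw [hV]
  exact hsub.lim_le_div hbdd hT

/-- `0 ≤ V_β(R)` (`⟨W⟩_β ≤ 1`). [cite: ForsstromViklund2025currents, Cor. 6.4 (p. 10)] -/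
theorem isingQuarkPotential_nonneg {β : ℝ} (hβ : 0 < β) (x : Probability.LatticeModels.Site d)
    {i j : Fin d} (hij : i ≠ j) (R : ℕ) : 0 ≤ isingQuarkPotential β x i j R := by
  refine ge_of_tendsto' (isingQuarkPotential_tendsto hβ x hij R) fun T => ?_
  refine div_nonneg ?_ (Nat.cast_nonneg T)
  rw [neg_nonneg]
  exact Real.log_nonpos (znWilsonLoopLimit_nonneg hβ.le x hij R T)
    (znWilsonLoopLimit_le_one hβ.le x hij R T)

/-- **`V_β(R) ≤ -R log tanh β`**: the quark potential grows at most linearly (from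
`(tanh β)^{RT} ≤ ⟨W_{R×T}⟩_β`; cf. FV Prop. 6.5, where the matching linear LOWER bound `V_β(R) ≥ a_β R`
is proved for small `β`). [cite: ForsstromViklund2025currents, Cor. 6.4 with Prop. 6.5 (p. 10)] -/
theorem isingQuarkPotential_le {β : ℝ} (hβ : 0 < β) (x : Probability.LatticeModels.Site d)
    {i j : Fin d} (hij : i ≠ j) (R : ℕ) :
    isingQuarkPotential β x i j R ≤ -(R : ℝ) * Real.log (Real.tanh β) := by
  have ht : 0 < Real.tanh β := by
    rw [Real.tanh_eq_sinh_div_cosh]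
    exact div_pos (Real.sinh_pos_iff.2 hβ) (Real.cosh_pos β)
  have h1 := isingQuarkPotential_le_div hβ x hij R (T := 1) one_ne_zero
  have hw := tanh_pow_le_znWilsonLoopLimit_two hβ.le x hij R 1
  rw [mul_one] at hw
  have hlog := Real.log_le_log (pow_pos ht R) hw
  rw [Real.log_pow] at hlog
  simp only [Nat.cast_one, div_one] at h1
  linarith

end QuarkPotential

end Literature.MathematicalPhysics.QuantumFieldTheory
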